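import Literature.NumberTheory.Automorphic.SymCoeffLatticeCoefficientPassages
import Literature.Algebra.Homology.GroupCohomologySemilinearKernel
import HarnessLib

/-!
# `ker (H^i(U, V) → H^i(U, V/ϖV)) = ϖ H^i(U, V)` in the coefficients-at-`p` model

Topic `NumberTheory/Automorphic`; namespaces `Literature.NumberTheory.Automorphic.LevelAction`
(generic) and `…ParallelWeight` (the `𝒪`-lattice `⨂_τ Sym^{k−2}(𝒪²)`); theorems only.  The
universal-coefficient injection `H^i(U, V)/ϖ ↪ H^i(U, V/ϖV)` of Hida theory ([Hida1994AIF, §3];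
[KhareThorne2017, §6.4]) for the semilinear coefficient maps of `LevelActionSemilinearPushforward`
(`GroupCohomologySemilinearKernel.ker_semimap_eq_smul_top` applied to the sections
`M(U, τ) → M(U, τ')`):

* `sectionsSemimap_surjective` — a SURJECTIVE equivariant coefficient map `φ : V → V'` induces a
  surjection on sections (lift the values on coset representatives, `τ(u)` being invertible for
  `u ∈ U`);
* `sectionsSemimap_eq_zero_iff` — if `ker φ = ϖV` with `ϖ` injective on `V`, a section maps to
  `0` iff it is `ϖ` times a section;
* **`ker_cohomologySemimap_eq_smul_top`** — then `ker H^i(φ) = ϖ H^i(U, τ)`;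
* **`ker_reductionCohomology_span_singleton`** — for the `𝒪`-lattice `⨂_τ Sym^{k−2}(𝒪²)` over a
  domain `𝒪` and `ϖ ≠ 0`: `ker (reductionCohomology (ϖ)) = ϖ H^i(U, ⨂_τ Sym(𝒪²))`.

## References

* H. Hida, Ann. Inst. Fourier 44 (1994), §3 (held). [Hida1994AIF]
* C. Khare, J. A. Thorne, Amer. J. Math. 139 (2017), §6.4 (arXiv:1409.7007, held). [KhareThorne2017]
* K. S. Brown, *Cohomology of Groups*, GTM 87 (1982), III.6 (held). [Brown1982CohomologyGroups]
-/

noncomputable section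

open CategoryTheory Literature.Algebra.Homology IsDedekindDomain NumberField
open scoped Pointwise

namespace Literature.NumberTheory.Automorphic.LevelAction

universe u

section Generic

variable {R R' : Type u} [CommRing R] [CommRing R'] {σ : R →+* R'} {Γ 𝒢 : Type u} [Group Γ] [Group 𝒢]
  (ι : Γ →* 𝒢) (Δ : Submonoid 𝒢) {V V' : Type u} [AddCommGroup V] [Module R V] [AddCommGroup V']
  [Module R' V'] (τ : Δ →* Module.End R V) (τ' : Δ →* Module.End R' V') (U : Subgroup 𝒢)
  (hU : U.toSubmonoid ≤ Δ) (φ : V →ₛₗ[σ] V') (hφ : ∀ (δ : Δ) (v : V), φ (τ δ v) = τ' δ (φ v))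

/-- `act` is multiplicative at elements of `Δ`: duplicate of `LevelAction.act_mul`
(`IntegralWeightHeckeModuleGL2.lean`, explicit-argument form), kept as a deprecated alias
(dedup-02460). [folklore] -/
@[deprecated act_mul (since := "2026-08-16")]
theorem act_mul_of_mem {a b : 𝒢} (ha : a ∈ Δ) (hb : b ∈ Δ) :
    act Δ τ (a * b) = act Δ τ a * act Δ τ b :=
  act_mul ha hb

include hU in
/-- `τ(u) τ(u⁻¹) = 1` on `V` for `u ∈ U` (in the `act` normal form). [folklore] -/
theorem act_mul_act_inv_of_mem_level {u : 𝒢} (hu : u ∈ U) (v : V) :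
    act Δ τ u (act Δ τ u⁻¹ v) = v := by
  rw [← Module.End.mul_apply, ← act_mul (θ := τ) (hU hu) (hU (U.inv_mem hu)), mul_inv_cancel, act_one,
    Module.End.one_apply]

include hU in
/-- `τ(u⁻¹) τ(u) = 1` on `V` for `u ∈ U`. [folklore] -/
theorem act_inv_mul_act_of_mem_level {u : 𝒢} (hu : u ∈ U) (v : V) :
    act Δ τ u⁻¹ (act Δ τ u v) = v := by
  rw [← Module.End.mul_apply, ← act_mul (θ := τ) (hU (U.inv_mem hu)) (hU hu), inv_mul_cancel, act_one,
    Module.End.one_apply]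

include hφ in
/-- `φ` intertwines `act`. [folklore] -/
theorem map_act (x : 𝒢) (v : V) : φ (act Δ τ x v) = act Δ τ' x (φ v) := by
  by_cases hx : x ∈ Δ
  · rw [act_of_mem hx, act_of_mem hx, hφ]
  · rw [act_of_not_mem hx, act_of_not_mem hx, LinearMap.zero_apply, LinearMap.zero_apply, map_zero]

/-- **A surjective equivariant coefficient map induces a surjection on sections** (lift the values on
coset representatives). [folklore] -/
theorem sectionsSemimap_surjective (hsurj : Function.Surjective φ) :
    Function.Surjective (sectionsSemimap Δ τ τ' U hU φ hφ) := by
  classical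
  intro f'
  -- coset representatives `r g ∈ g U`
  let r : 𝒢 → 𝒢 := fun g => ((g : 𝒢 ⧸ U)).out
  have hr : ∀ g, (r g)⁻¹ * g ∈ U := fun g => QuotientGroup.eq.1 (QuotientGroup.out_eq' (g : 𝒢 ⧸ U))
  have hrU : ∀ (g u : 𝒢), u ∈ U → r (g * u) = r g := fun g u hu => by
    have : ((g * u : 𝒢) : 𝒢 ⧸ U) = (g : 𝒢 ⧸ U) :=
      (QuotientGroup.eq.2 (by rwa [inv_mul_cancel_left])).symm
    simp only [r, this]
  -- lifts of the values of `f'`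
  choose F hF using fun x : 𝒢 => hsurj (f'.1 x)
  let f : 𝒢 → V := fun g => act Δ τ ((r g)⁻¹ * g)⁻¹ (F (r g))
  have hf : f ∈ sections Δ τ U := by
    rw [mem_sections_iff hU]
    intro g u hu
    change τ ⟨u, hU hu⟩ (act Δ τ ((r (g * u))⁻¹ * (g * u))⁻¹ (F (r (g * u)))) = act Δ τ ((r g)⁻¹ * g)⁻¹ (F (r g))
    rw [hrU g u hu, ← act_of_mem (hU hu),
      show ((r g)⁻¹ * (g * u))⁻¹ = u⁻¹ * ((r g)⁻¹ * g)⁻¹ by rw [← mul_assoc, mul_inv_rev],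
      act_mul (θ := τ) (hU (U.inv_mem hu)) (hU (U.inv_mem (hr g))), Module.End.mul_apply,
      act_mul_act_inv_of_mem_level Δ τ U hU hu]
  refine ⟨⟨f, hf⟩, Subtype.ext (funext fun g => ?_)⟩
  rw [coe_sectionsSemimap_apply]
  change φ (act Δ τ ((r g)⁻¹ * g)⁻¹ (F (r g))) = f'.1 g
  rw [map_act Δ τ τ' φ hφ, hF]
  -- the section property of `f'` at `(g ((r g)⁻¹ g)⁻¹, (r g)⁻¹ g)`:
  have h := (mem_sections_iff hU).1 f'.2 (g * ((r g)⁻¹ * g)⁻¹) ((r g)⁻¹ * g) (hr g)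
  rw [inv_mul_cancel_right, ← act_of_mem (hU (hr g))] at h
  have hrg : g * ((r g)⁻¹ * g)⁻¹ = r g := by rw [mul_inv_rev, inv_inv, mul_inv_cancel_left]
  rw [hrg] at h
  rw [← h, act_inv_mul_act_of_mem_level Δ τ' U hU (hr g)]

/-- **Sections killed by `φ` are `ϖ` times a section**, when `ker φ = ϖ V` and `ϖ` is injective on
`V`. [folklore] -/
theorem sectionsSemimap_eq_zero_iff (ϖ : R) (htf : ∀ v : V, ϖ • v = 0 → v = 0)
    (hker : ∀ v : V, φ v = 0 ↔ ∃ v', ϖ • v' = v) (f : sections Δ τ U) :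
    sectionsSemimap Δ τ τ' U hU φ hφ f = 0 ↔ ∃ f₀ : sections Δ τ U, ϖ • f₀ = f := by
  constructor
  · intro h
    have hg : ∀ g, ∃ v', ϖ • v' = f.1 g := fun g =>
      (hker _).1 (by
        have h' := congrArg (fun s : sections Δ τ' U => s.1 g) h
        simpa only [coe_sectionsSemimap_apply, ZeroMemClass.coe_zero, Pi.zero_apply] using h')
    choose f₀ hf₀ using hg
    have hf₀s : f₀ ∈ sections Δ τ U := by
      rw [mem_sections_iff hU]
      intro g u hu
      have h1 : ϖ • (τ ⟨u, hU hu⟩ (f₀ (g * u)) - f₀ g) = 0 := by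
        rw [smul_sub, ← map_smul, hf₀, hf₀, (mem_sections_iff hU).1 f.2 g u hu, sub_self]
      exact sub_eq_zero.1 (htf _ h1)
    exact ⟨⟨f₀, hf₀s⟩, Subtype.ext (funext fun g => hf₀ g)⟩
  · rintro ⟨f₀, rfl⟩
    refine Subtype.ext (funext fun g => ?_)
    rw [coe_sectionsSemimap_apply]
    exact (hker _).2 ⟨f₀.1 g, rfl⟩

/-- `ϖ` is injective on sections when it is on `V`. [folklore] -/
theorem smul_sections_eq_zero (ϖ : R) (htf : ∀ v : V, ϖ • v = 0 → v = 0) (f : sections Δ τ U)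
    (h : ϖ • f = 0) : f = 0 :=
  Subtype.ext (funext fun g => htf _ (by
    have h' := congrArg (fun s : sections Δ τ U => s.1 g) h
    simpa only [SetLike.val_smul, Pi.smul_apply, ZeroMemClass.coe_zero, Pi.zero_apply] using h'))

/-- **`ker (H^i(U, τ) → H^i(U, τ')) = ϖ H^i(U, τ)`** for a surjective equivariant coefficient map
`φ` with `ker φ = ϖ V`, `ϖ` injective on `V`: the universal coefficient injection
`H^i(U, V)/ϖ ↪ H^i(U, V/ϖV)`. [cite: Brown1982CohomologyGroups, III.6 Prop. 6.1] [cite: Hida1994AIF, §3] -/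
theorem ker_cohomologySemimap_eq_smul_top (ϖ : R) (htf : ∀ v : V, ϖ • v = 0 → v = 0)
    (hker : ∀ v : V, φ v = 0 ↔ ∃ v', ϖ • v' = v) (hsurj : Function.Surjective φ) (i : ℕ) :
    LinearMap.ker (cohomologySemimap ι Δ τ τ' U hU φ hφ i) =
      ϖ • (⊤ : Submodule R (cohomology ι Δ τ U i)) :=
  ker_semimap_eq_smul_top (A := Rep.of (rep ι Δ τ U)) (B := Rep.of (rep ι Δ τ' U)) ϖ
    (fun f hf => smul_sections_eq_zero Δ τ U ϖ htf f hf) (sectionsSemimap Δ τ τ' U hU φ hφ)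
    (fun γ f => sectionsSemimap_rep ι Δ τ τ' U hU φ hφ γ f)
    (fun f => sectionsSemimap_eq_zero_iff Δ τ τ' U hU φ hφ ϖ htf hker f)
    (sectionsSemimap_surjective Δ τ τ' U hU φ hφ hsurj) i

end Generic

end Literature.NumberTheory.Automorphic.LevelAction

/-! ### The `𝒪`-lattice `⨂_τ Sym^{k−2}(𝒪²)` -/

namespace Literature.NumberTheory.Automorphic.ParallelWeight

open BigHeckeGLn IntegralWeightGL2 LevelAction

variable (O : Type) [CommRing O] (E : Type) [Field E] [CharZero E] (F : Type) [Field F]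
  [NumberField F] (k : ℕ) (v : (F →+* E) → HeightOneSpectrum (𝓞 F))
  (φO : ∀ τ : F →+* E, (v τ).adicCompletionIntegers F →+* O) (ϖ : O)

/-- The lattice is `ϖ`-torsion-free for `ϖ ≠ 0` (free over a domain). [folklore] -/
theorem smul_lattice_eq_zero [IsDomain O] (hϖ : ϖ ≠ 0) (x : SymCoeffLattice O E F k) (h : ϖ • x = 0) : x = 0 := by
  haveI : Module.Free O (SymCoeffLattice O E F k) := Module.Free.of_basis (latticeBasis O E F k)
  exact (smul_eq_zero.1 h).resolve_left hϖ

/-- `latticeReduce (ϖ)` kills exactly `ϖ ·` the lattice. [folklore] -/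
theorem latticeReduce_eq_zero_iff (x : SymCoeffLattice O E F k) :
    latticeReduce O E F k (Ideal.span {ϖ}) x = 0 ↔ ∃ x', ϖ • x' = x := by
  rw [latticeReduce_apply, LinearEquiv.map_eq_zero_iff, Submodule.Quotient.mk_eq_zero,
    Submodule.ideal_span_singleton_smul]
  constructor
  · intro hx
    obtain ⟨y, -, rfl⟩ := (Submodule.mem_smul_pointwise_iff_exists _ _ _).1 hx
    exact ⟨y, rfl⟩
  · rintro ⟨x', rfl⟩
    exact Submodule.smul_mem_pointwise_smul _ _ _ Submodule.mem_top

/-- `latticeReduce` is surjective. [folklore] -/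
theorem latticeReduce_surjective (I : Ideal O) : Function.Surjective (latticeReduce O E F k I) := fun y => by
  obtain ⟨q, hq⟩ := (latticeQuotEquiv O E F k I).surjective y
  obtain ⟨x, rfl⟩ := Submodule.Quotient.mk_surjective _ q
  exact ⟨x, hq⟩

variable {Γ : Type} [Group Γ] (ι : Γ →* FiniteAdelicGL 2 F) {U : Subgroup (FiniteAdelicGL 2 F)}
  (hU : U.toSubmonoid ≤ integralMonoid F v) (i : ℕ)

/-- **`ker (H^i(U, ⨂_τ Sym(𝒪²)) → H^i(U, ⨂_τ Sym((𝒪/ϖ)²))) = ϖ H^i(U, ⨂_τ Sym(𝒪²))`** (`𝒪` a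
domain, `ϖ ≠ 0`): `H^i(U, V_𝒪)/ϖ ↪ H^i(U, V_{𝒪/ϖ})`. [cite: Hida1994AIF, §3] [cite: KhareThorne2017, §6.4] -/
theorem ker_reductionCohomology_span_singleton [IsDomain O] (hϖ : ϖ ≠ 0) :
    LinearMap.ker (reductionCohomology O E F k v φO (Ideal.span {ϖ}) ι hU i) =
      ϖ • (⊤ : Submodule O (LevelAction.cohomology ι (integralMonoid F v) (symLatticeAction O E F k v φO) U i)) :=
  ker_cohomologySemimap_eq_smul_top ι (integralMonoid F v) _ _ U hU (latticeReduce O E F k (Ideal.span {ϖ}))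
    (fun g x => latticeReduce_symLatticeAction O E F k v φO (Ideal.span {ϖ}) g x) ϖ
    (fun x hx => smul_lattice_eq_zero O E F k ϖ hϖ x hx) (latticeReduce_eq_zero_iff O E F k ϖ)
    (latticeReduce_surjective O E F k _) i

end Literature.NumberTheory.Automorphic.ParallelWeight
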